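import Summits.BirchSwinnertonDyer.BirchSwinnertonDyer.Theorems.GenusKolyvaginAtTwoK4NegPhantomCellDescentBit
import Summits.BirchSwinnertonDyer.BirchSwinnertonDyer.Theorems.GenusKolyvaginAtTwoGenusDeepSupplyAtTwoNegDiscNarrowDepthZeroAntiInvariantReading
import Summits.BirchSwinnertonDyer.BirchSwinnertonDyer.Theorems.GenusKolyvaginAtTwoGenusPrimitiveSupplyAtTwoTwistingPrimeEntangledCriterion
import Summits.BirchSwinnertonDyer.BirchSwinnertonDyer.Theorems.GenusKolyvaginAtTwoK4NegOfWallRowsU2AlphaOrNonPhantom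
import Literature.NumberTheory.EllipticCurves.SelmerTorsionTwistRestriction
import HarnessLib

/-!
# Route `GenusKolyvaginAtTwo`, crux `GenusDeepSupplyAtTwoNegDiscNarrow` (stmt-BirchSwinnertonDyer-23491), LINE 38 «steered_supply» —
# stub H₂ «TWIN TRANSPORT OF HALVES»: the ℚ-side twin bit implies the LEAD's K-side halving bit `hHalf`

LEAD seat `bsd-line-gk2-p1` g30 (cell `bsd-f1-sign2`), `--supports stmt-BirchSwinnertonDyer-23491 --as helper`.  THEOREMS ONLY (no
definition, no named fact, no `sorry`); standard axioms.  **BSD is NOT proved by this file; crux 23491 / `K4Neg` / U₂ / Q2 / WALL are NOT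
proved; nothing is closed by it.**

WHAT.  The pen's LINE 38 v1.2 (`Cruxes/GenusDeepSupplyAtTwoNegDiscNarrow/Lines/steered_supply.lean`, 2026-08-30T22:20Z) has exactly one
`sorry` left, the transport stub H₂ `stub_halvingBit_of_twinHalves`: on a prime Heegner frame `K = ℚ(√−ℓ₀)` of a rank-`0` curve `E = W/ℚ`,
IF no half of a non-divisible rational point of the twist `E^{(d_K)}` is fixed by `Γ_{ℚ(E[4])}` (the ℚ-side «twin bit», gk2-p4 §48), THEN
the LEAD g28's K-side HALVING BIT holds: every `R ∈ E(K)` having a half `Q ∈ E_K(K̄)` fixed by `Γ_{K(E[4])}` lies in `2E(K)`.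

* §1 sign-free bookkeeping for a signed untwisting `F : E^{(d)}(ℚ̄) ≃ E(ℚ̄)` (`F(σP) = ±σF(P)`, gk2-p4 g25
  `exists_twistIso_sign_absGaloisQuot`): on `2`-torsion the sign is invisible, so `Γ_{ℚ(E[2])}` fixes `E^{(d)}[2]`, and `E^{(d)}[2]^{Γ_ℚ} = 0`
  when `ρ̄_{E,2}` is onto.
* §2 ★ `halvingBit_of_twinHalves` — THE TRANSPORT (model-free: the twin is `W.quadraticTwist d_K` itself), hypotheses: `ρ_{E,2^n}` onto,
  `K` imaginary quadratic, `E(ℚ)` torsion (read in `E(ℚ̄)`), and the ℚ-side twin bit.  PROOF (the pen's «equivariance remark» made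
  kernel): for `R ∈ E(K)` with a `Γ_{K(E[4])}`-fixed half `Q`, pass to the anti-invariant multiple `A = m•R` (`m` odd, gk2-p3 g34
  `forall_fixed_odd_torsion_of_rank_zero`), which is `F z̃` for a rational twin point `z` (gk2-p4 g25 `exists_twin_point_of_anti`); the
  half `Q_d := F⁻¹ θ⁻¹(m•Q)` of `z̃` (`θ = RatClosure.pointsEquiv`, gk2-p3's dictionary) is fixed by `Γ_K ∩ Γ_{ℚ(E[4])}`; the map
  `c : g ↦ gQ_d − Q_d` on `N = Γ_{ℚ(E[4])}` is a homomorphism into `E^{(d)}[2]` vanishing on the index-`≤ 2` subgroup `N ∩ Γ_K`, and the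
  cocycle identity `c(σgσ⁻¹) = σ·c(g)` together with `absGaloisQuot(σgσ⁻¹g⁻¹) = 1` gives `σ·c(g) = c(g)` for all `σ ∈ Γ_ℚ`, so
  `c(g) ∈ E^{(d)}[2]^{Γ_ℚ} = 0`: `Q_d` is `Γ_{ℚ(E[4])}`-fixed, and the twin bit moves it — unless `z ∈ 2E^{(d)}(ℚ)`, in which case
  Galois descent over `K` halves `A`, hence `R`.
* §3 ★★ `halvingBit_of_steerAt` — H = H₂ ∘ H_ℚ of LINE 38: on a prime Heegner frame (`Δ < 0`, `d_K = −ℓ₀` odd, Heegner, `2` split, a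
  model `Wd` of the twin with `#Sel₂(Wd) = 2`, `r_an(E) = 0` + GZK `MultPublishedInputsAtTwo`) the steering clause `SteerAt W ℓ₀` (spelled
  out: every non-zero `2`-Selmer class of `W` dying on `Γ_{ℚ(W[4])}` is not locally trivial at `ℓ₀`) implies `hHalf` — via gk2-p4 g10's
  entanglement criterion `forall_torsionFixing_four_smul_eq_iff_exists_selmer` (§48) and §2.  This is the pen's `halvingBit_of_steer`
  with its idle binders (`¬CM`, `#Sel₂(W) = 4`, `r_an(Wd) = 1`, `BSD₂(E)`, `BSD₂(Wd)`) dropped: LINE 38 v1.3 closes its last `sorry` by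
  `exact halvingBit_of_steerAt W hr0 hρ hneg K hIQ hodd hHe ℓ₀ hdK h2K Wd hWd hSel hGZK hSt`.

References: [SilvermanAEC2009] X.5 Cor. 5.4, X.2 Prop. 2.4, VIII.§1–§2; [MazurRubin2010] Def. 3.1, Lemma 2.9–2.11, Prop. 3.3;
[LawsonWuthrich2016] §3, §7.1; [SerreGaloisCohomology1997] I.§5.8 (cocycle conjugation).
-/

set_option linter.dupNamespace false -- tree convention: `Summit.BirchSwinnertonDyer.BirchSwinnertonDyer.Theorems` (summit = sub-problem)
set_option autoImplicit false

noncomputable section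

open scoped Classical Pointwise

namespace Summit.BirchSwinnertonDyer.BirchSwinnertonDyer.Theorems.GenusExact.PlusDescent.TwinHalves

open WeierstrassCurve Field NumberField IsDedekindDomain
open Literature.NumberTheory.GaloisRepresentations Literature.NumberTheory.EllipticCurves
open Summit.BirchSwinnertonDyer.BirchSwinnertonDyer.Theorems.GenusSupplyNarrow.DepthZero
  (exists_twistIso_sign_absGaloisQuot exists_twin_point_of_anti)
open Summit.BirchSwinnertonDyer.BirchSwinnertonDyer.Theorems.GenusExact.PhantomDescentBit
  (pointsEquiv_map_absEmbedding_eq_toGeomPoints pointsEquiv_symm_smul forall_fixed_odd_torsion_of_rank_zero)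
open Summit.BirchSwinnertonDyer.BirchSwinnertonDyer.Theorems.GenusExact.PlusDescent.SocleSelection.RealVisible
  (mem_torsionFixing_baseChange_iff)
open Summit.BirchSwinnertonDyer.BirchSwinnertonDyer.Theorems.KolyvaginLowerBoundAtTwo (torsionFixing_le_of_dvd)

/-! ## §1 A signed untwisting is sign-free on `2`-torsion -/
section SignFree

variable {W : WeierstrassCurve ℚ} {d : ℚ}
  (F : (W.quadraticTwist d).geomPoints ≃+ W.geomPoints)
  (hF' : ∀ (σ : absoluteGaloisGroup ℚ) (P : (W.quadraticTwist d).geomPoints), F (σ • P) = σ • F P ∨ F (σ • P) = -(σ • F P))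

/-- `-T = T` for a point killed by `2`. [folklore] -/
theorem neg_eq_self_of_two_zsmul_eq_zero {A : Type*} [AddCommGroup A] {T : A} (hT : (2 : ℤ) • T = 0) : -T = T := by
  rw [two_zsmul] at hT
  exact (eq_neg_of_add_eq_zero_left hT).symm

include hF' in
/-- **On `2`-torsion a signed untwisting is equivariant**: `F(σT) = σF(T)` whenever `2T = 0` (the sign `±` is invisible on `E[2]`).
[cite: SilvermanAEC2009, X.5 Cor. 5.4] -/
theorem twistIso_smul_of_two_zsmul_eq_zero (σ : absoluteGaloisGroup ℚ) {T : (W.quadraticTwist d).geomPoints}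
    (hT : (2 : ℤ) • T = 0) : F (σ • T) = σ • F T := by
  rcases hF' σ T with h | h
  · exact h
  · rw [h, ← smul_neg, ← map_neg, neg_eq_self_of_two_zsmul_eq_zero hT]

include hF' in
/-- **`Γ_{ℚ(E[2])}` fixes `E^{(d)}[2]`** (through `F`, `E^{(d)}[2] ≅ E[2]` as Galois modules). [cite: SilvermanAEC2009, X.5 Cor. 5.4] -/
theorem smul_eq_of_mem_torsionFixing_two {g : absoluteGaloisGroup ℚ} (hg : g ∈ torsionFixing W (2 : ℤ))
    {T : (W.quadraticTwist d).geomPoints} (hT : (2 : ℤ) • T = 0) : g • T = T := by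
  have hFT : F T ∈ geomTorsion W (2 : ℤ) := by
    rw [mem_geomTorsion_iff, ← map_zsmul, hT, map_zero]
  have hfix : g • F T = F T := congrArg Subtype.val (smul_eq_of_mem_torsionFixing W (2 : ℤ) hg ⟨F T, hFT⟩)
  apply F.injective
  rw [twistIso_smul_of_two_zsmul_eq_zero F hF' g hT, hfix]

include hF' in
/-- **`E^{(d)}[2]^{Γ_ℚ} = 0` when `ρ̄_{E,2}` is onto** (`F` carries a `Γ_ℚ`-fixed `2`-torsion point of the twist to one of `E`, which is
rational by Galois descent and `0` by Dokchitser–Dokchitser (1)). [cite: DokchitserDokchitserMathZ2012, Theorem (1)]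
[cite: SilvermanAEC2009, VIII.§1, X.5 Cor. 5.4] -/
theorem eq_zero_of_two_zsmul_eq_zero_of_forall_smul_eq [W.IsElliptic] (hs : W.HasSurjectiveModNGaloisRep 2)
    {T : (W.quadraticTwist d).geomPoints} (hT : (2 : ℤ) • T = 0) (hfix : ∀ σ : absoluteGaloisGroup ℚ, σ • T = T) : T = 0 := by
  letI instD : DecidableEq ℚ := fun a b ↦ Classical.propDecidable (a = b)
  haveI : PerfectField ℚ := PerfectField.ofCharZero
  have hFfix : ∀ σ : absoluteGaloisGroup ℚ, σ • F T = F T := fun σ ↦ by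
    rw [← twistIso_smul_of_two_zsmul_eq_zero F hF' σ hT, hfix σ]
  obtain ⟨s, hs'⟩ := W.exists_toGeomPoints_eq_of_forall_smul_eq hFfix
  have h2s : 2 • s = 0 := by
    apply toGeomPoints_injective W
    rw [map_nsmul, map_zero, hs', ← natCast_zsmul, Nat.cast_ofNat, ← map_zsmul, hT, map_zero]
  have hs0 : s = 0 := DokchitserDokchitser2012.forall_two_nsmul_of_hasSurjectiveModNGaloisRep_two W two_ne_zero hs s h2s
  apply F.injective
  rw [map_zero, ← hs', hs0, map_zero]

end SignFree

/-! ## §2 The transport: ℚ-side twin bit ⟹ K-side halving bit -/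
section Transport

variable (W : WeierstrassCurve ℚ) [W.IsElliptic] {K : Type} [Field K] [NumberField K]

/-- ★ **TWIN TRANSPORT OF HALVES** (stub H₂ of LINE 38, model-free form).  `E = W/ℚ` elliptic with `ρ_{E,2^n}` onto for all `n ≥ 1`;
`K` imaginary quadratic; `E(ℚ)` torsion (every rational point has finite order in `E(ℚ̄)`); and the ℚ-side TWIN BIT for the quadratic
twist `E^{(d_K)} = W.quadraticTwist d_K`: every half `Q_d ∈ E^{(d_K)}(ℚ̄)` of a rational point `z` none of whose `E^{(d_K)}[2]`-translates is
rational (i.e. `z ∉ 2E^{(d_K)}(ℚ)`) is MOVED by some `h ∈ Γ_{ℚ(E[4])}`.  THEN the halving bit `hHalf` holds over `K`: every `R ∈ E(K)` with a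
half `Q ∈ E_K(K̄)` fixed by `Γ_{K(E[4])}` lies in `2E(K)`.  Proof in the module docstring (anti-invariant multiple, signed untwisting,
cocycle conjugation). [cite: SilvermanAEC2009, X.5 Cor. 5.4, VIII.§1–§2] [cite: MazurRubin2010, Lemma 2.9] [cite: LawsonWuthrich2016, §3] -/
theorem halvingBit_of_twinHalves
    (hρ : ∀ n : ℕ, 0 < n → W.HasSurjectiveModNGaloisRep ((2 : ℤ) ^ n)) (hIQ : IsImaginaryQuadratic K)
    (htor : ∀ s : W.toAffine.Point, IsOfFinAddOrder (WeierstrassCurve.toGeomPoints W s))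
    (hQtw : ∀ (z : (W.quadraticTwist (discr K : ℚ)).toAffine.Point) (Qd : (W.quadraticTwist (discr K : ℚ)).geomPoints),
      (2 : ℤ) • Qd = toGeomPoints (W.quadraticTwist (discr K : ℚ)) z →
      (∀ T ∈ geomTorsion (W.quadraticTwist (discr K : ℚ)) (2 : ℤ),
        Qd - T ∉ MulAction.fixedPoints (absoluteGaloisGroup ℚ) (W.quadraticTwist (discr K : ℚ)).geomPoints) →
      ∃ h ∈ torsionFixing W (4 : ℤ), h • Qd ≠ Qd) :
    ∀ (R : (W.baseChange K).toAffine.Point) (Q : geomPoints (W.baseChange K)),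
      (∀ ρ ∈ torsionFixing (W.baseChange K) (4 : ℤ), ρ • Q = Q) → (2 : ℤ) • Q = toGeomPoints (W.baseChange K) R →
      ∃ R' : (W.baseChange K).toAffine.Point, (2 : ℤ) • R' = R := by
  letI instD : DecidableEq ℚ := fun a b ↦ Classical.propDecidable (a = b)
  intro R Q hQfix hQ
  have h2 : Module.finrank ℚ K = 2 := hIQ.1
  haveI : Algebra.IsQuadraticExtension ℚ K := ⟨h2⟩
  haveI : IsGalois ℚ K := inferInstance
  haveI : PerfectField ℚ := PerfectField.ofCharZero
  haveI : PerfectField K := PerfectField.ofCharZero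
  have hs2 : W.HasSurjectiveModNGaloisRep 2 := by simpa using hρ 1 one_pos
  set V := W.quadraticTwist (discr K : ℚ) with hVdef
  -- the non-trivial automorphism `τ` of `K`
  have hcard : Nat.card (K ≃ₐ[ℚ] K) = 2 := by rw [IsGalois.card_aut_eq_finrank, h2]
  obtain ⟨τ, hτ1⟩ : ∃ τ : K ≃ₐ[ℚ] K, τ ≠ 1 := by
    by_contra h
    push Not at h
    haveI : Subsingleton (K ≃ₐ[ℚ] K) := ⟨fun a b ↦ (h a).trans (h b).symm⟩
    have := hcard ▸ Nat.card_of_subsingleton (1 : K ≃ₐ[ℚ] K)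
    omega
  have hττ : τ * τ = 1 := by
    rcases Literature.NumberTheory.QuadraticFields.eq_one_or_eq_of_card_eq_two hcard hτ1 (τ * τ) with h | h
    · exact h
    · exact absurd (mul_left_cancel (a := τ) (h.trans (mul_one τ).symm)) hτ1
  have hsq : ∀ x : K ≃ₐ[ℚ] K, x * x = 1 := fun x ↦ by
    rcases Literature.NumberTheory.QuadraticFields.eq_one_or_eq_of_card_eq_two hcard hτ1 x with rfl | rfl
    · exact mul_one 1
    · exact hττ
  have hcommK : ∀ a b : K ≃ₐ[ℚ] K, a * b * a⁻¹ * b⁻¹ = 1 := fun a b ↦ by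
    rw [inv_eq_of_mul_eq_one_right (hsq a), inv_eq_of_mul_eq_one_right (hsq b), mul_assoc (a * b) a b]
    exact hsq (a * b)
  -- `R + τR` is `Aut`-fixed, hence `m • (R + τR) = 0` with `m` odd; `A := m • R` is anti-invariant
  have hRfix : ∀ σ : K ≃ₐ[ℚ] K, σ • (R + τ • R) = R + τ • R := by
    intro σ
    rcases Literature.NumberTheory.QuadraticFields.eq_one_or_eq_of_card_eq_two hcard hτ1 σ with rfl | rfl
    · exact one_smul _ _
    · rw [smul_add, ← mul_smul, hττ, one_smul, add_comm]
  obtain ⟨m, hm, hmR⟩ := forall_fixed_odd_torsion_of_rank_zero W hρ hIQ htor (R + τ • R) hRfix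
  set A : (W.baseChange K).toAffine.Point := (m : ℤ) • R with hAdef
  have hanti : τ • A = -A := by
    have hτR : τ • R = -R + (R + τ • R) := by abel
    have hsm : τ • ((m : ℤ) • R) = (m : ℤ) • (τ • R) := map_zsmul (DistribSMul.toAddMonoidHom _ τ) (m : ℤ) R
    rw [hAdef, hsm, hτR, smul_add, hmR, add_zero, smul_neg]
  -- reduction: it suffices to halve `A`
  suffices hSA : ∃ S : (W.baseChange K).toAffine.Point, (2 : ℤ) • S = A by
    obtain ⟨S, hS⟩ := hSA
    obtain ⟨k, hk⟩ := hm
    refine ⟨S - (k : ℤ) • R, ?_⟩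
    have hmR' : (m : ℤ) • R = (2 : ℤ) • ((k : ℤ) • R) + R := by rw [hk]; push_cast; rw [add_smul, one_smul, mul_smul]
    rw [smul_sub, hS, hAdef, hmR', add_sub_cancel_left]
  -- the half `QA := m • Q` of `ι A`, fixed by `Γ_{K(E[4])}`
  set QA : geomPoints (W.baseChange K) := (m : ℤ) • Q with hQAdef
  have hQA : (2 : ℤ) • QA = toGeomPoints (W.baseChange K) A := by rw [hQAdef, smul_comm, hQ, hAdef, map_zsmul]
  have hQAfix : ∀ ρ ∈ torsionFixing (W.baseChange K) (4 : ℤ), ρ • QA = QA := fun ρ hρ' ↦ by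
    rw [hQAdef, smul_zsmul_geomPoints, hQfix ρ hρ']
  by_contra hA
  -- the signed untwisting `F` and the rational twin point `z` under `A`
  obtain ⟨F, hF⟩ := exists_twistIso_sign_absGaloisQuot W hIQ
  have hF' : ∀ (σ : absoluteGaloisGroup ℚ) (P : V.geomPoints), F (σ • P) = σ • F P ∨ F (σ • P) = -(σ • F P) := fun σ P ↦ by
    rcases hF σ with ⟨-, h⟩ | ⟨-, h⟩
    · exact Or.inl (h P)
    · exact Or.inr (h P)
  have hFplus : ∀ σ : absoluteGaloisGroup ℚ, absGaloisQuot ℚ K σ = 1 → ∀ P : V.geomPoints, F (σ • P) = σ • F P := fun σ hσ P ↦ by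
    rcases hF σ with ⟨-, h⟩ | ⟨hne, -⟩
    · exact h P
    · exact absurd hσ hne
  obtain ⟨z, hz⟩ := exists_twin_point_of_anti W hIQ hτ1 F hF hanti
  -- the dictionary `θ : E(ℚ̄) ≃ E_K(K̄)`
  set θ := RatClosure.pointsEquiv (K := K) W with hθdef
  set eA : W.geomPoints := Affine.Point.map (W' := W) (absEmbedding ℚ K) A with heA
  have hθA : θ eA = toGeomPoints (W.baseChange K) A := pointsEquiv_map_absEmbedding_eq_toGeomPoints W A
  -- `H := θ⁻¹ QA`, a half of `e_* A = F z̃`; `Qd := F⁻¹ H`, a half of `z̃`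
  set H : W.geomPoints := θ.symm QA with hHdef
  have h2H : (2 : ℤ) • H = eA := by
    apply θ.injective
    rw [map_zsmul, hHdef, θ.apply_symm_apply, hQA, hθA]
  set Qd : V.geomPoints := F.symm H with hQddef
  have h2Qd : (2 : ℤ) • Qd = toGeomPoints V z := by
    apply F.injective
    rw [map_zsmul, hQddef, F.apply_symm_apply, h2H, hz]
  -- `z ∉ 2 E^{(d)}(ℚ)`: otherwise `A ∈ 2E(K)` by Galois descent over `K`
  have hz2 : ¬ ∃ z' : V.toAffine.Point, (2 : ℤ) • z' = z := by
    rintro ⟨z', hz'⟩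
    apply hA
    -- `H' := F z̃'` is a half of `e_*A` fixed by `res(Γ_K)`
    have hH'fix : ∀ ρ : absoluteGaloisGroup K, ρ • θ (F (toGeomPoints V z')) = θ (F (toGeomPoints V z')) := fun ρ ↦ by
      rw [← RatClosure.pointsEquiv_smul, ← hFplus _ (absGaloisQuot_absGaloisRestrict ℚ K ρ), smul_toGeomPoints]
    obtain ⟨S, hS⟩ := (W.baseChange K).exists_toGeomPoints_eq_of_forall_smul_eq hH'fix
    refine ⟨S, toGeomPoints_injective (W.baseChange K) ?_⟩
    rw [map_zsmul, hS, ← map_zsmul, ← map_zsmul, ← map_zsmul, hz', hz, hθA]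
  -- no `E^{(d)}[2]`-translate of `Qd` is rational
  have hP : ∀ T ∈ geomTorsion V (2 : ℤ), Qd - T ∉ MulAction.fixedPoints (absoluteGaloisGroup ℚ) V.geomPoints := by
    intro T hT hfixT
    obtain ⟨z'', hz''⟩ := V.exists_toGeomPoints_eq_of_forall_smul_eq (Q := Qd - T) hfixT
    have hT2 : (2 : ℤ) • T = 0 := (mem_geomTorsion_iff V (2 : ℤ) T).mp hT
    exact hz2 ⟨z'', toGeomPoints_injective V (by rw [map_zsmul, hz'', smul_sub, hT2, sub_zero, h2Qd])⟩
  -- the cocycle `c(g) := g • Qd − Qd` on `N = Γ_{ℚ(E[4])}`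
  have hN2 : torsionFixing W (4 : ℤ) ≤ torsionFixing W (2 : ℤ) := torsionFixing_le_of_dvd W ⟨2, by norm_num⟩
  have hc2 : ∀ g : absoluteGaloisGroup ℚ, (2 : ℤ) • (g • Qd - Qd) = 0 := fun g ↦ by
    rw [smul_sub, ← smul_zsmul_geomPoints, h2Qd, smul_toGeomPoints, sub_self]
  -- (a) `c` vanishes on `N ∩ res(Γ_K)`
  have hker : ∀ g ∈ torsionFixing W (4 : ℤ), absGaloisQuot ℚ K g = 1 → g • Qd = Qd := by
    intro g hg hg1
    obtain ⟨ρ, hρg⟩ := (absGaloisQuot_eq_one_iff ℚ K g).mp hg1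
    have hρg' : absGaloisRestrict ℚ K ρ = g := hρg
    subst hρg'
    have hρ4 : ρ ∈ torsionFixing (W.baseChange K) (4 : ℤ) := (mem_torsionFixing_baseChange_iff W K (4 : ℤ) ρ).mpr hg
    have hgH : absGaloisRestrict ℚ K ρ • H = H := by
      rw [hHdef, ← pointsEquiv_symm_smul, hQAfix ρ hρ4]
    apply F.injective
    rw [hFplus _ hg1, hQddef, F.apply_symm_apply]
    exact hgH
  -- (b) `c` is additive on `N`
  have hadd : ∀ g₁ ∈ torsionFixing W (4 : ℤ), ∀ g₂ : absoluteGaloisGroup ℚ,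
      (g₁ * g₂) • Qd - Qd = (g₁ • Qd - Qd) + (g₂ • Qd - Qd) := by
    intro g₁ hg₁ g₂
    have hfixc : g₁ • (g₂ • Qd - Qd) = g₂ • Qd - Qd := smul_eq_of_mem_torsionFixing_two F hF' (hN2 hg₁) (hc2 g₂)
    rw [smul_sub] at hfixc
    rw [mul_smul, show g₁ • g₂ • Qd = g₁ • g₂ • Qd - g₁ • Qd + g₁ • Qd from (sub_add_cancel _ _).symm, hfixc]
    abel
  -- (c) `c(σ g σ⁻¹) = σ • c(g)` for `g ∈ N`
  have hconj : ∀ g ∈ torsionFixing W (4 : ℤ), ∀ σ : absoluteGaloisGroup ℚ,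
      (σ * g * σ⁻¹) • Qd - Qd = σ • (g • Qd - Qd) := by
    intro g hg σ
    have hTσ : (2 : ℤ) • (σ⁻¹ • Qd - Qd) = 0 := hc2 σ⁻¹
    have hgT : g • (σ⁻¹ • Qd - Qd) = σ⁻¹ • Qd - Qd := smul_eq_of_mem_torsionFixing_two F hF' (hN2 hg) hTσ
    have h1 : g • σ⁻¹ • Qd = g • Qd + (σ⁻¹ • Qd - Qd) := by
      have h0 : σ⁻¹ • Qd = Qd + (σ⁻¹ • Qd - Qd) := by abel
      conv_lhs => rw [h0]
      rw [smul_add, hgT]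
    have h3 : σ • (σ⁻¹ • Qd - Qd) = Qd - σ • Qd := by rw [smul_sub, smul_inv_smul]
    calc (σ * g * σ⁻¹) • Qd - Qd = σ • (g • Qd + (σ⁻¹ • Qd - Qd)) - Qd := by rw [mul_smul, mul_smul, h1]
      _ = σ • (g • Qd) + (Qd - σ • Qd) - Qd := by rw [smul_add, h3]
      _ = σ • (g • Qd) - σ • Qd := by abel
      _ = σ • (g • Qd - Qd) := by rw [smul_sub]
  -- (d) hence `σ • c(g) = c(g)` for all `σ`, and `c(g) = 0`
  have hcfix : ∀ g ∈ torsionFixing W (4 : ℤ), ∀ σ : absoluteGaloisGroup ℚ, σ • (g • Qd - Qd) = g • Qd - Qd := by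
    intro g hg σ
    have hgN : σ * g * σ⁻¹ ∈ torsionFixing W (4 : ℤ) := (torsionFixing_normal W (4 : ℤ)).conj_mem g hg σ
    have hcomm : σ * g * σ⁻¹ * g⁻¹ ∈ torsionFixing W (4 : ℤ) := mul_mem hgN (inv_mem hg)
    have hq1 : absGaloisQuot ℚ K (σ * g * σ⁻¹ * g⁻¹) = 1 := by
      rw [map_mul, map_mul, map_mul, map_inv, map_inv]
      exact hcommK _ _
    have hzero : (σ * g * σ⁻¹ * g⁻¹) • Qd - Qd = 0 := by rw [hker _ hcomm hq1, sub_self]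
    have hsplit := hadd _ hcomm g
    rw [show σ * g * σ⁻¹ * g⁻¹ * g = σ * g * σ⁻¹ by group, hconj g hg σ, hzero, zero_add] at hsplit
    exact hsplit
  have hQdfix : ∀ g ∈ torsionFixing W (4 : ℤ), g • Qd = Qd := fun g hg ↦
    sub_eq_zero.mp (eq_zero_of_two_zsmul_eq_zero_of_forall_smul_eq F hF' hs2 (hc2 g) (hcfix g hg))
  -- the twin bit moves `Qd`: contradiction
  obtain ⟨h, hh, hne⟩ := hQtw z Qd h2Qd hP
  exact hne (hQdfix h hh)

end Transport

/-! ## §3 The steered form: `SteerAt W ℓ₀ ⟹ hHalf` on a prime Heegner frame (LINE 38's `halvingBit_of_steer`) -/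
section Steer

open Summit.BirchSwinnertonDyer.BirchSwinnertonDyer.Theses.GenusKolyvaginAtTwo (MultPublishedInputsAtTwo)
open Summit.BirchSwinnertonDyer.BirchSwinnertonDyer.Theorems.GenusKolyTwistingPrime
  (forall_torsionFixing_four_smul_eq_iff_exists_selmer strictLocalKer_eq_torsionLocalKer)

/-- ★★ **`SteerAt W ℓ₀ ⟹ hHalf`** (LINE 38's `halvingBit_of_steer`, load-bearing binders only).  `E = W/ℚ` globally minimal with `Δ < 0`,
analytic rank `0` and `ρ_{E,2^n}` onto; `K` imaginary quadratic with odd `d_K = −ℓ₀`, Heegner for `N_E`, `2` split; `Wd` an elliptic model of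
the twist `E^{(d_K)}` with `#Sel₂(Wd) = 2`; GZK (`MultPublishedInputsAtTwo`, PRINT: `rank E(ℚ) = r_an = 0`); and the STEERING CLAUSE (body of
the pen's `SteerAt W ℓ₀`): every non-zero class of `Sel₂(W)` dying on `Γ_{ℚ(W[4])}` is NOT locally trivial at `ℓ₀`.  THEN every `R ∈ E(K)`
with a `Γ_{K(E[4])}`-fixed half lies in `2E(K)`.  Proof: gk2-p4's entanglement criterion (§48) turns the steering clause into the ℚ-side twin
bit for `W.quadraticTwist d_K` (Selmer count transported along `C`), and §2 transports it to `K`.  CONDITIONAL only on the PRINT item GZK;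
BSD is NOT proved; nothing is closed. [cite: MazurRubin2010, Def. 3.1, Lemma 2.10–2.11, Prop. 3.3] [cite: LawsonWuthrich2016, §3]
[cite: SilvermanAEC2009, X.5 Cor. 5.4, VIII.§2] -/
theorem halvingBit_of_steerAt
    (W : WeierstrassCurve ℚ) [W.IsElliptic] [W.IsGloballyMinimal]
    (hr0 : W.analyticRank = 0) (hρ : ∀ n : ℕ, 0 < n → W.HasSurjectiveModNGaloisRep ((2 : ℤ) ^ n)) (hneg : W.Δ < 0)
    (K : Type) [Field K] [NumberField K] (hIQ : IsImaginaryQuadratic K) (hodd : Odd (discr K))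
    (hHe : SatisfiesHeegnerHypothesis (W.conductorNorm ℤ) K)
    (ℓ₀ : ℕ) [Fact ℓ₀.Prime] (hdK : discr K = -(ℓ₀ : ℤ)) (h2K : ((Ideal.span {(2 : ℤ)}).primesOver (𝓞 K)).ncard = 2)
    (Wd : WeierstrassCurve ℚ) [Wd.IsElliptic] (hWd : ∃ C : VariableChange ℚ, C • W.quadraticTwist (discr K : ℚ) = Wd)
    (hSel : Nat.card (Wd.selmerGroup 2) = 2) (hGZK : MultPublishedInputsAtTwo)
    (hSt : ∀ y : galH1Torsion W (2 : ℤ), y ∈ W.selmerGroup 2 → y ≠ 0 →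
      (∀ h ∈ torsionFixing W (4 : ℤ), h1Eval W (2 : ℤ) y h = 0) → y ∉ W.torsionLocalKer ℚ_[ℓ₀] (2 : ℤ)) :
    ∀ (R : (W.baseChange K).toAffine.Point) (Q : geomPoints (W.baseChange K)),
      (∀ ρ ∈ torsionFixing (W.baseChange K) (4 : ℤ), ρ • Q = Q) → (2 : ℤ) • Q = toGeomPoints (W.baseChange K) R →
      ∃ R' : (W.baseChange K).toAffine.Point, (2 : ℤ) • R' = R := by
  -- `E(ℚ)` is torsion (rank `0` through GZK), read in `E(ℚ̄)`
  have hrk0 : W.mordellWeilRank = 0 := by rw [(hGZK W (by rw [hr0]; exact zero_le_one)).1, hr0]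
  haveI : Finite W.toAffine.Point := W.mordellWeilRank_eq_zero_iff_finite.mp hrk0
  have htor : ∀ s : W.toAffine.Point, IsOfFinAddOrder (WeierstrassCurve.toGeomPoints W s) :=
    isOfFinAddOrder_toGeomPoints_of_finite W
  -- the twin `W.quadraticTwist d_K` itself is a model (`C = 1`) with `#Sel₂ = 2`
  have hd0 : (discr K : ℚ) ≠ 0 := by exact_mod_cast NumberField.discr_ne_zero K
  haveI := W.isElliptic_quadraticTwist hd0
  obtain ⟨C, hC⟩ := hWd
  have hSel' : Nat.card ((W.quadraticTwist (discr K : ℚ)).selmerGroup 2) = 2 := by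
    rw [natCard_selmerGroup_eq_of_variableChange (2 : ℤ) hC, hSel]
  have h1 : (1 : VariableChange ℚ) • W.quadraticTwist (discr K : ℚ) = W.quadraticTwist (discr K : ℚ) := one_smul _ _
  refine halvingBit_of_twinHalves W hρ hIQ htor fun z Qd hQd hP ↦ ?_
  -- gk2-p4's criterion: an entangled half forces a non-zero dying Selmer class strict at `ℓ₀`, excluded by the steering clause
  by_contra hcon
  push Not at hcon
  obtain ⟨y, hyS, hy0, hyd, hys⟩ :=
    (forall_torsionFixing_four_smul_eq_iff_exists_selmer W hneg hIQ hodd hHe h2K hdK h1 hSel' z Qd hQd hP).mp hcon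
  rw [strictLocalKer_eq_torsionLocalKer] at hys
  exact hSt y hyS hy0 hyd hys

end Steer

end Summit.BirchSwinnertonDyer.BirchSwinnertonDyer.Theorems.GenusExact.PlusDescent.TwinHalves

end
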